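import Literature.NumberTheory.GaloisCohomology.RestrictedRamificationExtComparison
import Literature.NumberTheory.GaloisRepresentations.SUnitsRestrictedTateDual
import HarnessLib

/-!
# `cmp` instantiated: `Extʳ_{C_{G_S}}(M^{N_S}, Ē_S) ≃+ Hʳ(G_S, (M^D)^{N_S})` for a finite `n`-torsion `Γ_K`-module `M`
# unramified outside `S ⊇ S_n` (Harari Lemma 17.21 (a) with `Hom(M, Ē_S) = M^D`; Milne ADT I Lemma 4.12, §0 (0.8))

Topic `NumberTheory/GaloisCohomology`; namespace `Literature.NumberTheory.GaloisCohomology.RestrictedExt`.  Definitions WITH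
BODIES (the identification `e_S` read in `C_{G_S}` and the instantiated comparison) and theorems; no named fact, no
instance, no notation, no `sorry`.  Sequel of `RestrictedRamificationExtComparison` (bsd-eis -w7 g12: the generic `cmp`
`extAddEquivRestrictedCohomology ρ S A ES hA hES e n : Ext A ES n ≃+ restrictedCohomology ρ S n` for `A` finite killed by `m`,
`m •` onto `ES`, `e : M^{N_S} ≅ Hom(A, ES)` a parameter) and of -w7 g11's `SUnitsRestrictedTateDual` (the `S`-version of
`HomDual.tateDualUnitsIso`: **`tateDualSUnitsRestrictedIso K S n ρ hn hM hur : (M^D)^{N_S} ≅ Hom_ℤ(M^{N_S}, Ē_S)`** in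
`TopRep ℤ G_S`, for `M` `n`-torsion, unramified outside `S`, all primes of `n` in `S`).

WHAT IS HERE — the parameter `e` SUPPLIED for the instantiation of -w2's `ShaExtRoad` at `ρ := ρ₀.tateDual n`,
`A := ⟨M₀^{N_S}⟩`, `ES := ⟨Ē_S⟩` (the template's shape, `HomDualShaTwoObstruction`: the `Ш²` side carries `M₀^D`):
* §1 `ofContinuousRep_homContRep` (any `Γ`): -w7 g11's `homContRep ρN ρ` IS door-c4's `ihomObj (ofContinuousRep ρN)
  (ofContinuousRep ρ)` in `C_Γ` (definitionally; the `Γ_K`-case is door-c4's `ofDiscreteGaloisModule_homGaloisModule`).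
* §2 `dvd_mem_of_mem` / `exists_eq_nsmul_sUnitsRestricted_of_mem` (`n •` is onto `Ē_S` when `(n) ∈ v ⇒ v ∈ S`),
  `nsmul_obj_ofContinuousRep_quotientInvariants_eq_zero`.
* §3 **`tateDualSUnitsIsoD K S n ρ hn hM hur : stdBase ((ρ.tateDual n).quotientInvariants N_S).toTopRep _ ≅
  ihomObj (ofContinuousRep (ρ.quotientInvariants N_S)) (ofContinuousRep (sUnitsRestricted K S))`** in `C_{G_S}` and its
  elementwise formula (`Φ_S : f ↦ (m ↦ ι (f m))`).
* §4 **`extAddEquivRestrictedCohomologyTateDual K S n ρ hn hM hur r :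
  Ext (ofContinuousRep (ρ.quotientInvariants N_S)) (ofContinuousRep (sUnitsRestricted K S)) r ≃+ restrictedCohomology (ρ.tateDual n) S r`**
  — `Extʳ_{G_S}(M, E_S) = Hʳ(G_S, M^D)` with every hypothesis discharged from `hn`/`hM`/`hur`, and `_bijective`.

Lane «PT-Ш-S-TC» of crux `stmt-BirchSwinnertonDyer-19032` (cell bsd-eis, seat bsd-line-x1-p1-w7 gen 12, brick D4a file E).
HONEST FRAMING: an identification of homological algebra; no duality theorem and no case of BSD is proved here.  AI
formalisation, established only by the kernel check.

## References
* D. Harari, *Galois Cohomology and Class Field Theory*, Universitext (2020), Lemma 17.21 (a) (p. 297). [Harari2020]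
* J. S. Milne, *Arithmetic Duality Theorems*, 2nd ed. (2006), I §0 (0.8), I Lemma 4.12, I Thm. 4.10 (a) (proof, p. 58).
  [MilneADT2006]
* J. Neukirch, A. Schmidt, K. Wingberg, *Cohomology of Number Fields*, 2nd ed. (2008), VIII §3 (8.3.18). [NeukirchSchmidtWingberg2008]
-/

noncomputable section

open CategoryTheory CategoryTheory.Abelian NumberField IsDedekindDomain
open Literature.Algebra.Homology Literature.Algebra.Homology.DiscreteRep
open Literature.NumberTheory.GaloisRepresentations
open scoped NumberField

namespace Literature.NumberTheory.GaloisCohomology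

namespace RestrictedExt

/-! ## §1 `homContRep` is `ihomObj` in `C_Γ` -/

section Generic

variable {Γ : Type} [Group Γ] [TopologicalSpace Γ] [IsTopologicalGroup Γ]
  {MN M : Type} [AddCommGroup MN] [TopologicalSpace MN] [DiscreteTopology MN] [Module.Finite ℤ MN]
  [AddCommGroup M] [TopologicalSpace M] [DiscreteTopology M]

/-- **In `C_Γ` the module `Hom_ℤ(N, M)` of -w7 g11's `ContHomDual.homContRep` is door-c4's internal Hom `ihomObj`**
(definitionally; generic-`Γ` form of `ofDiscreteGaloisModule_homGaloisModule`).
[cite: Harari2020, §16.2, Definition 16.10 and Remark 16.13][cite: MilneADT2006, I §0 (0.8)] -/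
theorem ofContinuousRep_homContRep (ρN : ContinuousRep Γ ℤ MN) (ρ : ContinuousRep Γ ℤ M) :
    ofContinuousRep (ContHomDual.homContRep ρN ρ) = ihomObj (ofContinuousRep ρN) (ofContinuousRep ρ) := rfl

end Generic

/-! ## §2 The hypotheses of the generic `cmp` at `A := ⟨M^{N_S}⟩`, `ES := ⟨Ē_S⟩` -/

section Hypotheses

variable (K : Type) [Field K] [NumberField K] (S : Set (HeightOneSpectrum (𝓞 K))) (n : ℕ) [NeZero n]

omit [NumberField K] [NeZero n] in
/-- If `(n) ∈ v ⇒ v ∈ S` then every divisor `p` of `n` has `(p) ∈ v ⇒ v ∈ S` (`(n) ⊆ (p)`).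
[cite: Harari2020, Lemma 17.21 (a) ("`#M ∈ 𝒪_{k,S}ˣ`")] -/
theorem dvd_mem_of_mem (hn : ∀ v : HeightOneSpectrum (𝓞 K), ((n : ℕ) : 𝓞 K) ∈ v.asIdeal → v ∈ S)
    (p : ℕ) (hp : p ∣ n) (v : HeightOneSpectrum (𝓞 K)) (hv : ((p : ℕ) : 𝓞 K) ∈ v.asIdeal) : v ∈ S := by
  obtain ⟨c, rfl⟩ := hp
  exact hn v (by rw [Nat.cast_mul]; exact v.asIdeal.mul_mem_right _ hv)

omit [NeZero n] in
/-- **`n •` is onto `Ē_S`** when `n ≠ 0` and `(n) ∈ v ⇒ v ∈ S` (`exists_eq_nsmul_sUnitsRestricted` with `dvd_mem_of_mem`).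
[cite: Harari2020, Lemma 17.21 (a) (proof)][cite: NeukirchSchmidtWingberg2008, VIII §3 (8.3.18)] -/
theorem exists_eq_nsmul_sUnitsRestricted_of_mem (hn0 : n ≠ 0)
    (hn : ∀ v : HeightOneSpectrum (𝓞 K), ((n : ℕ) : 𝓞 K) ∈ v.asIdeal → v ∈ S)
    (w : Representation.invariants
      ((SUnits.sUnitsModule K S).toRepresentation.comp (ramificationSubgroup K S).subtype)) :
    ∃ w', w = n • w' :=
  exists_eq_nsmul_sUnitsRestricted K S hn0 (fun p _ hpn v hv => dvd_mem_of_mem K S n hn p hpn v hv) w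

variable {M : Type} [AddCommGroup M] [TopologicalSpace M] [DiscreteTopology M] [Finite M] (ρ : DiscreteGaloisModule K M)

omit [NumberField K] [NeZero n] [Finite M] in
/-- The carrier of `⟨M^{N_S}⟩ = ofContinuousRep (ρ.quotientInvariants N_S)` is killed by `n` when `M` is.
[cite: MilneADT2006, I §0 (0.8)] -/
theorem nsmul_obj_ofContinuousRep_quotientInvariants_eq_zero (hM : ∀ m : M, n • m = 0)
    (a : (ofContinuousRep (ρ.quotientInvariants (ramificationSubgroup K S))).obj.V) : n • a = 0 :=
  ContHomDual.nsmul_invariants_eq_zero K S n ρ hM a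

end Hypotheses

/-! ## §3 `e_S` in `C_{G_S}`: `(M^D)^{N_S} ≅ Hom(⟨M^{N_S}⟩, ⟨Ē_S⟩)` -/

section Iso

variable (K : Type) [Field K] [NumberField K] (S : Set (HeightOneSpectrum (𝓞 K))) (n : ℕ) [NeZero n]
  {M : Type} [AddCommGroup M] [TopologicalSpace M] [DiscreteTopology M] [Finite M] (ρ : DiscreteGaloisModule K M)

/-- **`e_S : (M^D)^{N_S} ≅ Hom(M^{N_S}, Ē_S)` as an isomorphism of `C_{G_S}`** between the base `stdBase` of the
coefficient representation of `restrictedCohomology (ρ.tateDual n) S` and door-c4's internal Hom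
`ihomObj ⟨M^{N_S}⟩ ⟨Ē_S⟩` — -w7 g11's `tateDualSUnitsRestrictedIso` (in `TopRep ℤ G_S`) pushed through `forgetTop` into the
full subcategory `C_{G_S}` (`M` `n`-torsion, unramified outside `S`, all primes of `n` in `S`).  This is the parameter `e`
of `extAddEquivRestrictedCohomology` for the instantiation `A := ⟨M^{N_S}⟩`, `ES := ⟨Ē_S⟩`, module `ρ.tateDual n`.
[cite: MilneADT2006, I §0 (0.8), I §4 (p. 58)][cite: Harari2020, Lemma 17.21 (a)] -/
def tateDualSUnitsIsoD (hn : ∀ v : HeightOneSpectrum (𝓞 K), ((n : ℕ) : 𝓞 K) ∈ v.asIdeal → v ∈ S)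
    (hM : ∀ m : M, n • m = 0) (hur : ramificationSubgroup K S ≤ ContinuousRep.ker ρ) :
    stdBase ((ρ.tateDual n).quotientInvariants (ramificationSubgroup K S)).toTopRep
        (isDiscrete_quotientInvariants (ρ.tateDual n) S) ≅
      ihomObj (ofContinuousRep (ρ.quotientInvariants (ramificationSubgroup K S)))
        (ofContinuousRep (SUnits.sUnitsRestricted K S)) :=
  (DiscreteRep.isDiscrete ℤ (GaloisGroupUnramifiedOutside K S)).isoMk
    ((forgetTop ℤ (GaloisGroupUnramifiedOutside K S)).mapIso
      (ContHomDual.tateDualSUnitsRestrictedIso K S n ρ hn hM hur))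

/-- Elementwise: `e_S` is `Φ_S`, `f ↦ (m ↦ ι (f m))`. [cite: MilneADT2006, I §0 (0.8), I §4 (p. 58)] -/
@[simp] theorem tateDualSUnitsIsoD_hom_hom_apply
    (hn : ∀ v : HeightOneSpectrum (𝓞 K), ((n : ℕ) : 𝓞 K) ∈ v.asIdeal → v ∈ S)
    (hM : ∀ m : M, n • m = 0) (hur : ramificationSubgroup K S ≤ ContinuousRep.ker ρ)
    (f : Representation.invariants ((ρ.tateDual n).toRepresentation.comp (ramificationSubgroup K S).subtype)) :
    (tateDualSUnitsIsoD K S n ρ hn hM hur).hom.hom f = ContHomDual.tateDualToHomSUnits K S n ρ hn f := rfl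

end Iso

/-! ## §4 The instantiated comparison `Extʳ(⟨M^{N_S}⟩, ⟨Ē_S⟩) ≃+ Hʳ(G_S, (M^D)^{N_S})` -/

section Instantiated

variable (K : Type) [Field K] [NumberField K] (S : Set (HeightOneSpectrum (𝓞 K))) (n : ℕ) [NeZero n]
  {M : Type} [AddCommGroup M] [TopologicalSpace M] [DiscreteTopology M] [Finite M] (ρ : DiscreteGaloisModule K M)

/-- **`cmp` for the `S`-restricted `Ш`-pairing, instantiated: `Extʳ_{C_{G_S}}(⟨M^{N_S}⟩, ⟨Ē_S⟩) ≃+ Hʳ(G_S, (M^D)^{N_S})`**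
(`restrictedCohomology (ρ.tateDual n) S r`) for `M` finite, `n`-torsion, unramified outside `S`, every `v ∣ n` in `S` —
Harari Lemma 17.21 (a) / Milne I Lemma 4.12 with all hypotheses of the generic comparison discharged: `⟨M^{N_S}⟩` is killed
by `n`, `n •` is onto `Ē_S` (Kummer theory outside `S ⊇ S_n`), and `e := tateDualSUnitsIsoD`.
[cite: Harari2020, Lemma 17.21 (a)][cite: MilneADT2006, I Lemma 4.12, I Thm. 4.10 (a) (proof, p. 58)] -/
def extAddEquivRestrictedCohomologyTateDual
    (hn : ∀ v : HeightOneSpectrum (𝓞 K), ((n : ℕ) : 𝓞 K) ∈ v.asIdeal → v ∈ S)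
    (hM : ∀ m : M, n • m = 0) (hur : ramificationSubgroup K S ≤ ContinuousRep.ker ρ) (r : ℕ) :
    Ext (ofContinuousRep (ρ.quotientInvariants (ramificationSubgroup K S)))
        (ofContinuousRep (SUnits.sUnitsRestricted K S)) r ≃+
      DiscreteGaloisModule.restrictedCohomology (ρ.tateDual n) S r :=
  extAddEquivRestrictedCohomology (ρ.tateDual n) S
    (ofContinuousRep (ρ.quotientInvariants (ramificationSubgroup K S))) (ofContinuousRep (SUnits.sUnitsRestricted K S))
    (nsmul_obj_ofContinuousRep_quotientInvariants_eq_zero K S n ρ hM)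
    (exists_eq_nsmul_sUnitsRestricted_of_mem K S n (NeZero.ne n) hn) (tateDualSUnitsIsoD K S n ρ hn hM hur) r

/-- It is the generic `extAddEquivRestrictedCohomology` at `A := ⟨M^{N_S}⟩`, `ES := ⟨Ē_S⟩`, `e := tateDualSUnitsIsoD`
(no new map). [cite: Harari2020, Lemma 17.21 (a)] -/
theorem extAddEquivRestrictedCohomologyTateDual_eq
    (hn : ∀ v : HeightOneSpectrum (𝓞 K), ((n : ℕ) : 𝓞 K) ∈ v.asIdeal → v ∈ S)
    (hM : ∀ m : M, n • m = 0) (hur : ramificationSubgroup K S ≤ ContinuousRep.ker ρ) (r : ℕ) :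
    extAddEquivRestrictedCohomologyTateDual K S n ρ hn hM hur r =
      extAddEquivRestrictedCohomology (ρ.tateDual n) S
        (ofContinuousRep (ρ.quotientInvariants (ramificationSubgroup K S)))
        (ofContinuousRep (SUnits.sUnitsRestricted K S))
        (nsmul_obj_ofContinuousRep_quotientInvariants_eq_zero K S n ρ hM)
        (exists_eq_nsmul_sUnitsRestricted_of_mem K S n (NeZero.ne n) hn) (tateDualSUnitsIsoD K S n ρ hn hM hur) r :=
  rfl

/-- **`cmp` is bijective** (in particular injective: the `hcmp` of `ShaExtRoad.pairing_perfect`).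
[cite: Harari2020, Lemma 17.21 (a)][cite: MilneADT2006, I Thm. 4.10 (a) (proof, p. 58)] -/
theorem extAddEquivRestrictedCohomologyTateDual_bijective
    (hn : ∀ v : HeightOneSpectrum (𝓞 K), ((n : ℕ) : 𝓞 K) ∈ v.asIdeal → v ∈ S)
    (hM : ∀ m : M, n • m = 0) (hur : ramificationSubgroup K S ≤ ContinuousRep.ker ρ) (r : ℕ) :
    Function.Bijective (extAddEquivRestrictedCohomologyTateDual K S n ρ hn hM hur r).toAddMonoidHom :=
  (extAddEquivRestrictedCohomologyTateDual K S n ρ hn hM hur r).bijective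

end Instantiated

end RestrictedExt

end Literature.NumberTheory.GaloisCohomology

end
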